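import Summits.Langlands.Langlands.Theorems.IrreducibilityBySelfDualityIrreducibleOffSectorOfReciprocity
import Literature.NumberTheory.Automorphic.ChebotarevArtinRepHolds
import Literature.NumberTheory.GaloisRepresentations.FramedRepEquivConj
import HarnessLib

/-!
# The summit from `ReciprocityUpToIrreducibility` and Arthur–Clozel (2.2)–(2.3) alone — STRUCTURAL
(crux stmt-Langlands-14329 `IrreducibilityBySelfDuality.IrreducibleOffSector`, line `Sketch`;
`--supports` file; imports `Summits.Langlands.Statement` + landed structural modules + Literature only,
so that the route's deciding theorem `closes` can call it without an import cycle)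

`langlands_iff_reciprocityUpToIrreducibility_of_JS` (p104397, `…IrreducibleOffSectorCollapse`) records,
on the route decls, that granted Arthur–Clozel (2.2)–(2.3) for Borel–Jacquet data the summit
`Langlands` is EQUIVALENT to the single crux `ReciprocityUpToIrreducibility` (E); but that file imports
the route module and cannot be used inside `closes`.  This file gives the useful direction
STRUCTURALLY, on the texts:

**Theorem** (`langlands_of_reciprocityUpToIrreducibility_text_of_JS`).  The named facts
`JacquetShalika1981_partialPairL_boundary_repData` (= the route input `PairLBoundaryJS`, definitionally)
and `JacquetShalika1981_partialPairL_pole_repData`, and the text of E, imply `Langlands`.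

Proof: clause (B) is E's; in clause (A) the avatar `ρ` of E's (A') is irreducible — as is EVERY
a.e.-compatible `ρ'` — by the isobaric bootstrap `isIrreducible_of_reciprocityUpToIrreducibility`
(p103935), and uniqueness up to conjugacy among corresponding `ρ'` follows as in the route's deciding
theorem: irreducible ⇒ semisimple, equal Satake parameters a.e. (`hasSatakeParamAt_unique_holds`) ⇒
equal Frobenius polynomials a.e. ⇒ equivalent (Chebotarev + Brauer–Nesbitt,
`FramedGaloisRep.nonempty_equiv_of_hasFrobCharpolyAt_eventually chebotarev_artinRep_holds`) ⇒ conjugate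
(`FramedRep.exists_eq_conj_of_equiv`).

For the planner: with an input item `i7 : JacquetShalika1981_partialPairL_pole_repData` (or its
Mœglin–Waldspurger leaf) filed, `closes` can read
`exact langlands_of_reciprocityUpToIrreducibility_text_of_JS i4 i7 cE`; the crux cO
(`IrreducibleOffSector`, stmt-Langlands-14329) is then no longer a hypothesis of the deciding theorem,
and the sector cruxes survive as the route's standalone theorem T (`IrreducibleGL3CM.frame_proof`).

References: F. Calegari, T. Gee, Ann. Inst. Fourier 63 (2013), §1.1; K. Buzzard, T. Gee, LMS LNS 414
(2014), Conj. 3.2.1–3.2.2; P. Deligne, J.-P. Serre, ASENS 7 (1974), Lemme 3.2.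
-/

noncomputable section

set_option linter.dupNamespace false

open scoped NumberField Classical
open Filter IsDedekindDomain
open Literature.NumberTheory.Automorphic Literature.NumberTheory.GaloisRepresentations
open Summit.Langlands

namespace Summit.Langlands.Langlands.Theorems.IrreducibleOffSector

/-- **`Langlands` from the text of `ReciprocityUpToIrreducibility` and Arthur–Clozel (2.2)–(2.3) for
Borel–Jacquet data**, structurally: clause (B) is E's, clause (A)'s irreducibility is the isobaric
bootstrap for every a.e.-compatible avatar, and uniqueness up to conjugacy is Chebotarev–Brauer–Nesbitt
on semisimple (because irreducible) avatars with equal Frobenius polynomials a.e.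
[cite: CalegariGee2013, §1.1] [cite: BuzzardGeeLMS2014, Conj. 3.2.1 and Conj. 3.2.2]
[cite: DeligneSerreASENS1974, Lemme 3.2] -/
theorem langlands_of_reciprocityUpToIrreducibility_text_of_JS
    (h22 : JacquetShalika1981_partialPairL_boundary_repData)
    (h23 : JacquetShalika1981_partialPairL_pole_repData)
    (cE : ∀ (F : Type) [Field F] [NumberField F], ∃ Rec : ReciprocityData F, ∀ n : ℕ, 0 < n → ∀ hcpt : Literature.NumberTheory.Automorphic.isCompact_glFiniteIntegralLevel n F, (∀ π : Literature.NumberTheory.Automorphic.CuspidalAutomorphicRepData n F hcpt, π.1.IsLAlgebraic → ∀ (ℓ : ℕ) [Fact ℓ.Prime] (ι : PadicAlgCl ℓ ≃+* ℂ), ∃ ρ : Literature.NumberTheory.GaloisRepresentations.FramedGaloisRep F (PadicAlgCl ℓ) n, IsGeometricFramed Rec ρ ∧ Corresponds Rec ι π.1 ρ) ∧ GaloisToAutomorphic n Rec hcpt) :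
    _root_.Langlands := by
  intro F _ _
  obtain ⟨Rec, hRec⟩ := cE F
  refine ⟨Rec, fun n hn hcpt => ?_⟩
  obtain ⟨hA, hB⟩ := hRec n hn hcpt
  refine ⟨?_, hB⟩
  intro π hL ℓ _ ι
  -- irreducibility of EVERY avatar Satake–Frobenius compatible a.e. with `π`: the isobaric bootstrap
  have irr : ∀ ρ : FramedGaloisRep F (PadicAlgCl ℓ) n,
      (∀ᶠ v : HeightOneSpectrum (𝓞 F) in cofinite, SatakeFrobCompatibleAt ι π.1 ρ v) →
        ρ.toGaloisRep.IsIrreducible :=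
    fun ρ hρ => isIrreducible_of_reciprocityUpToIrreducibility h22 h23 hRec hcpt hn π hL ι ρ hρ
  obtain ⟨ρ, hgeo, hcorr⟩ := hA π hL ℓ ι
  refine ⟨ρ, irr ρ hcorr.1, hgeo, hcorr, fun ρ' hcorr' => ?_⟩
  -- uniqueness up to conjugacy: irreducible ⇒ semisimple; equal Satake parameters a.e. (Flath)
  -- ⇒ equal Frobenius polynomials a.e. ⇒ equivalent (Chebotarev + Brauer–Nesbitt) ⇒ conjugate
  have h1 : ρ.toGaloisRep.IsIrreducible := irr ρ hcorr.1
  have h2 : ρ'.toGaloisRep.IsIrreducible := irr ρ' hcorr'.1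
  have hs1 : ρ.toGaloisRep.IsSemisimple := by
    haveI := h1
    change ComplementedLattice _
    infer_instance
  have hs2 : ρ'.toGaloisRep.IsSemisimple := by
    haveI := h2
    change ComplementedLattice _
    infer_instance
  have hev : ∀ᶠ v : HeightOneSpectrum (𝓞 F) in cofinite,
      ρ.IsUnramifiedAt v ∧ ρ'.IsUnramifiedAt v ∧
        ∃ P : Polynomial (PadicAlgCl ℓ), ρ.HasFrobCharpolyAt v P ∧ ρ'.HasFrobCharpolyAt v P := by
    filter_upwards [hcorr.1, hcorr'.1] with v hv hv'
    obtain ⟨α, hα, hur, hcp⟩ := hv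
    obtain ⟨α', hα', hur', hcp'⟩ := hv'
    obtain rfl : α = α' := AutomorphicRepData.hasSatakeParamAt_unique_holds π.1 hα hα'
    exact ⟨hur, hur', _, hcp, hcp'⟩
  obtain ⟨e⟩ := FramedGaloisRep.nonempty_equiv_of_hasFrobCharpolyAt_eventually
    chebotarev_artinRep_holds ρ ρ' hs1 hs2 hev
  obtain ⟨P, hP⟩ := FramedRep.exists_eq_conj_of_equiv ρ ρ' e
  exact ⟨P, hP.symm⟩

end Summit.Langlands.Langlands.Theorems.IrreducibleOffSector

end
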